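import Literature.MathematicalPhysics.QuantumLattice.HubbardTTPrimeDoccTransportThermal
import Literature.MathematicalPhysics.QuantumLattice.HubbardTTPrimeThermalPressureGrandCanonicalCeiling
import Literature.MathematicalPhysics.QuantumLattice.HubbardTTPrimeThermalPressureLimit
import Literature.MathematicalPhysics.QuantumLattice.TorusFreeThermalLaw
import Literature.MathematicalPhysics.QuantumLattice.DWaveSourceFreeColdPressure
import Literature.MathematicalPhysics.QuantumLattice.HartreeFockFreeFermionThermodynamicLimit
import Literature.Probability.LatticeModels.BrillouinRiemannSum
import HarnessLib

/-!
# The thermal double occupancy of the 2D Hubbard model is capped by the FREE-ENTROPY CHORD from `U = 0`: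
# `β·U·D(ω) ≤ p(β; t,t',0; n) − p(β; t,t',U; n) ≤ P₀(β, μ) − βμn + β·e^{up}(t,t',U,n)`, with the free end an
# explicit Brillouin-zone integral

Topic `MathematicalPhysics/QuantumLattice` (family `hubbard`); a consumer's corollary of three tree results, written for
the Kosterlitz–Thouless back-end of cell `pub/hubbard-tc` (MO-S3, seat `hubbard-tc-mod-2`), which needs a CERTIFIED
thermal double-occupancy cap `D(ω) ≤ d^{up}` at one inverse temperature `β` to close a monotonicity-free `T_KT` row
(`Summits/…/Observables/StiffnessThermalCouplingDilution.lean`, ROUTE T-A″/T-A‴ mixed form) and so far had to take it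
from a finite-temperature SDP certificate. Here the cap is obtained WITHOUT any thermal certificate:

* §1 THE CHORD (Peierls–Bogoliubov for the sector free energy, which is concave in `U`; finite volume =
  `log_partitionFn_sector_sub_mem_Icc_U`, passed to the thermodynamic limit along the tori defining the state):
  for every torus limit `ω` of the canonical `(rectN n L, S^z = 0)` sector Gibbs states of `hubbardTorusTT' L t s U` at
  `β > 0` and every `0 ≤ U₁ ≤ U`,
  `β (U − U₁) · D(ω) ≤ p(β; t,s,U₁; n) − p(β; t,s,U; n)`  (`IsTorusLimitOfMixture.mul_meanEnergy_onSite_le_pressureTT'_sub`),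
  `D(ω) = e_{Φ(0,0,1)}(ω)` the double-occupancy density, `p = ThermodynamicLimit.pressureTT'` the canonical sector pressure
  of record; with the ground-state anchor `p(β; t,s,U; n) ≥ −β e(t,s,U,n)` (`pressureTT'_mem_Icc`) any certified `T = 0`
  UPPER bound `e(t,s,U,n) ≤ e^{up}` closes the cold end (`…le_pressureTT'_add_of_upper`).
* §2 THE FREE END: at `U₁ = 0`, `t = 1`, `s = 0` the grand-canonical partition function is the plane-wave product
  (`log_partitionFn_hubbardTorusWith_zero_eq`), i.e. `log Ξ_L(β, μ) = Σ_k 2 log(1 + e^{−β(ε_L(k) − μ)})`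
  (`log_partitionFn_free_eq_sum`), a corner Riemann sum of the continuous periodic function
  `freeLogWeight β μ p = 2 log(1 + e^{−β(2 Σᵢ cos pᵢ − μ)})`; hence `L⁻² log Ξ_L → P₀(β, μ) := (2π)⁻² ∫_{[−π,π]²} freeLogWeight β μ`
  (`tendsto_log_partitionFn_free_div_sq`, `tendsto_cornerRiemannSum`) and, by the canonical ⇐ grand-canonical ceiling
  (`pressureTT'_add_le_of_grandCanonical_ceiling`), `p(β; 1,0,0; n) ≤ P₀(β, μ) − βμn` for EVERY real `μ`
  (`pressureTT'_free_le_freeGCPressure_sub`).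
* §3 THE CAP: `U · D(ω) ≤ (P₀(β, μ) − βμn)/β + e^{up}` for every thermal torus limit at `(β, 1, 0, U, n)`
  (`IsTorusLimitOfMixture.mul_meanEnergy_onSite_le_of_freeGCPressure_of_upper`), and its reader shape with a certified
  quadrature ceiling `P₀(β, μ) ≤ P` (`…le_of_freeGCPressure_le_of_upper`): the only inputs are a `T = 0` energy UPPER
  bound at `(U, n)` and ONE elementary two-dimensional integral of an explicit smooth function.

SIZING (floats, cell pub/hubbard-tc STATUS 2026-08-27T16:01Z, not used here): `β·t = 13/4`, `n = ⅞`, `U = 8`, `μ = −0.307`: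
`P₀ = 4.56011`, `P₀ − βμn = 5.43314 = −β·F_free`, `e^{up} = −0.70594` (mbsolver CERTIFIED #354) ⇒ `D ≤ 0.12072`, below the SDP
certificate `0.13062` of the same temperature.

HONEST SCOPE: a one-sided CAP on a thermal expectation from convexity; no certificate, no number, no phase word; the
integral `P₀` is DEFINED here (with its `tendsto`), its numerical enclosure is a claim node elsewhere. Everything is PROVED;
two definitions with bodies (`freeLogWeight`, `freeGCPressure`), no named fact.

## Mathlib / tree search

REUSED: `log_partitionFn_sector_sub_mem_Icc_U`, `IsTorusLimitOfMixture.tendsto_meanEnergy_hubbardTTPrime`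
(`HubbardTTPrimeDoccTransportThermal`, `TorusLimitOfMixtures`); `tendsto_log_partitionFn_div_sq_comp`, `pressureTT'_mem_Icc`
(`HubbardTTPrimeThermalPressureLimit`); `pressureTT'_add_le_of_grandCanonical_ceiling`
(`HubbardTTPrimeThermalPressureGrandCanonicalCeiling`); `log_partitionFn_hubbardTorusWith_zero_eq` (`TorusFreeThermalLaw`),
`log_one_add_cosh_div_two` (`BdGModeGainBound`), `log_one_add_cosh_div_two_eq_add_log` (`DWaveSourceFreeColdPressure`),
`card_orb_fermionTorus_two`, `hubbardTorusTT'_zero`, `hubbardTorusWith_eq`; `HartreeFock.sum_cellCorner_div_eq`,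
`latticeMomentum_eq_cellCorner_add`, `tendsto_cornerRiemannSum`, `isCompact_brillouin`.
`lean search 'docc.*pressureTT|freeGCPressure|log_partitionFn_free'`: nothing (2026-08-27).

## References

* E. H. Lieb, Commun. Math. Phys. 31 (1973) 327, §V (5.2)–(5.4) (`λ⟨A⟩_{H+λA} ≤ f(H) − f(H+λA) ≤ λ⟨A⟩_H`, the
  Peierls–Bogoliubov bracket). [cite: Lieb1973, §V (5.2)–(5.4)]
* D. Ruelle, *Statistical Mechanics: Rigorous Results* (1969), §3.4 (canonical vs grand-canonical pressure of lattice
  systems; the free lattice gas). [cite: Ruelle1969, §3.4]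
* N. W. Ashcroft, N. D. Mermin, *Solid State Physics* (1976), Ch. 2 eq. (2.49) (grand potential of the free electron gas
  `−k_BT Σ_k log(1 + e^{−β(ε_k−μ)})`). [cite: AshcroftMermin1976, Ch. 2 eq. (2.49)]
* S. Friedli, Y. Velenik, *Statistical Mechanics of Lattice Systems* (2017), §10.5.2 (momentum sums → Brillouin integrals).
  [cite: FriedliVelenikSMLS2017, §10.5.2]
-/

noncomputable section

namespace Literature.MathematicalPhysics.QuantumLattice

open Matrix Finset Real MeasureTheory HubbardWave0 Literature.Probability.LatticeModels ThermodynamicLimit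
open _root_.Filter
open scoped _root_.Topology ComplexOrder BigOperators

/-! ### §1 The Peierls–Bogoliubov chord in the thermodynamic limit -/

namespace InfVolFermionState

variable {t s n β : ℝ}

/-- **The free-entropy chord caps the thermal double occupancy.** For a torus limit `ω` of the canonical sector Gibbs
states of `hubbardTorusTT' L t s U` at `β > 0` (`U ≥ 0`, `0 ≤ n < 2`) and every `0 ≤ U₁ ≤ U`:
`β (U − U₁) · D(ω) ≤ p(β; t,s,U₁; n) − p(β; t,s,U; n)` — the finite-volume Peierls–Bogoliubov bracket
`β(U−U₁)⟨D⟩_{L,U} ≤ log Z_L(U₁) − log Z_L(U)` divided by `L²` along the tori `Ls` defining `ω`.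
[cite: Lieb1973, §V (5.2)–(5.4)] [cite: Ruelle1969, §3.4] -/
theorem IsTorusLimitOfMixture.mul_meanEnergy_onSite_le_pressureTT'_sub
    (hβ : 0 < β) (hn0 : 0 ≤ n) (hn2 : n < 2) {U₁ U : ℝ} (hU₁ : 0 ≤ U₁) (hU₁U : U₁ ≤ U)
    {ω : InfVolFermionState 2} {Ls : ℕ → ℕ}
    (h : ω.IsTorusLimitOfMixture (sectorGibbsCount n) (fun L => sectorGibbsWeightTT' β t s U n L)
      (fun L => sectorGibbsVectorTT' t s U n L) Ls) (hLs : Tendsto Ls atTop atTop) :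
    β * (U - U₁) * ω.meanEnergy (hubbardTTPrimeFermionInteraction 0 0 1) 1 ≤
      pressureTT' β t s U₁ n - pressureTT' β t s U n := by
  have hU : 0 ≤ U := hU₁.trans hU₁U
  have hD := h.tendsto_meanEnergy_hubbardTTPrime 0 0 1 hLs
  have hp₁ := tendsto_log_partitionFn_div_sq_comp hβ.le t s hU₁ hn0 hn2 hLs
  have hp := tendsto_log_partitionFn_div_sq_comp hβ.le t s hU hn0 hn2 hLs
  refine le_of_tendsto_of_tendsto ((hD.const_mul (β * (U - U₁)))) (hp₁.sub hp) ?_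
  filter_upwards [hLs.eventually_ge_atTop 1] with j hj
  haveI : NeZero (Ls j) := ⟨by omega⟩
  have hL2 : (0 : ℝ) < (Ls j : ℝ) ^ 2 := by positivity
  have hb := (log_partitionFn_sector_sub_mem_Icc_U hn0 hn2.le (Ls j) t s β U₁ U).1
  have hsum : ∑ i, sectorGibbsWeightTT' β t s U n (Ls j) i *
      ((QuantumLattice.expect (hubbardTorusTT' (Ls j) 0 0 1) (sectorGibbsVectorTT' t s U n (Ls j) i)).re /
        (Ls j : ℝ) ^ 2) =
      (∑ i, sectorGibbsWeightTT' β t s U n (Ls j) i *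
        (QuantumLattice.expect (hubbardTorusTT' (Ls j) 0 0 1) (sectorGibbsVectorTT' t s U n (Ls j) i)).re) /
        (Ls j : ℝ) ^ 2 := by
    rw [Finset.sum_div]
    exact Finset.sum_congr rfl fun i _ => by ring
  rw [hsum, ← sub_div, mul_div_assoc']
  refine div_le_div_of_nonneg_right ?_ hL2.le
  rw [mul_assoc]
  exact hb

/-- **Cold end by a ground-state UPPER bound.** Under the hypotheses of
`mul_meanEnergy_onSite_le_pressureTT'_sub` with `U₁ < U` and a certified upper bound `e(t,s,U,n) ≤ e^{up}`:
`β (U − U₁) · D(ω) ≤ p(β; t,s,U₁; n) + β·e^{up}` (the anchor `−β e(t,s,U,n) ≤ p(β; t,s,U; n)` of `pressureTT'_mem_Icc`).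
[cite: Lieb1973, §V (5.2)–(5.4)] [cite: Ruelle1969, §3.4] -/
theorem IsTorusLimitOfMixture.mul_meanEnergy_onSite_le_pressureTT'_add_of_upper
    (hβ : 0 < β) (hn0 : 0 ≤ n) (hn2 : n < 2) {U₁ U : ℝ} (hU₁ : 0 ≤ U₁) (hU₁U : U₁ ≤ U) {eup : ℝ}
    (hup : energyDensityTT' t s U n ≤ eup)
    {ω : InfVolFermionState 2} {Ls : ℕ → ℕ}
    (h : ω.IsTorusLimitOfMixture (sectorGibbsCount n) (fun L => sectorGibbsWeightTT' β t s U n L)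
      (fun L => sectorGibbsVectorTT' t s U n L) Ls) (hLs : Tendsto Ls atTop atTop) :
    β * (U - U₁) * ω.meanEnergy (hubbardTTPrimeFermionInteraction 0 0 1) 1 ≤
      pressureTT' β t s U₁ n + β * eup := by
  have hU : 0 ≤ U := hU₁.trans hU₁U
  have h1 := h.mul_meanEnergy_onSite_le_pressureTT'_sub hβ hn0 hn2 hU₁ hU₁U hLs
  have h2 := (pressureTT'_mem_Icc hβ.le t s hU hn0 hn2).1
  have h3 : β * energyDensityTT' t s U n ≤ β * eup := mul_le_mul_of_nonneg_left hup hβ.le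
  linarith

end InfVolFermionState

/-! ### §2 The free end: the grand-canonical pressure of the square-lattice Fermi gas as a Brillouin-zone integral -/

/-- The free grand-canonical log-weight of one momentum (both spins), in the corner coordinates `p = c_k` of the
Brillouin torus (`ε_L(k) = 2 Σᵢ cos (c_k)ᵢ`, `latticeMomentum_eq_cellCorner_add`):
`freeLogWeight β μ p = 2 log(1 + e^{−β(2 Σᵢ cos pᵢ − μ)})`. [cite: AshcroftMermin1976, Ch. 2 eq. (2.49)] -/
def freeLogWeight (β μ : ℝ) (p : Fin 2 → ℝ) : ℝ :=
  2 * Real.log (1 + Real.exp (-(β * (2 * ∑ i, Real.cos (p i) - μ))))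

/-- **The free grand-canonical pressure of the square lattice** (`t = 1`, `t' = 0`, `U = 0`, both spins, in units of
`log` per site): `P₀(β, μ) = (2π)⁻² ∫_{[−π,π]²} 2 log(1 + e^{−β(2(cos p₁ + cos p₂) − μ)}) dp`; it is the limit of
`L⁻² log Tr e^{−β(H_L(1,0,0) − μN)}` (`tendsto_log_partitionFn_free_div_sq`). [cite: AshcroftMermin1976, Ch. 2 eq. (2.49)] -/
def freeGCPressure (β μ : ℝ) : ℝ :=
  ((2 * π) ^ 2)⁻¹ * ∫ p in brillouin 2, freeLogWeight β μ p

/-- `freeLogWeight` is continuous. [folklore] -/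
private theorem continuous_freeLogWeight (β μ : ℝ) : Continuous (freeLogWeight β μ) := by
  unfold freeLogWeight
  have hpos : ∀ p : Fin 2 → ℝ, 1 + Real.exp (-(β * (2 * ∑ i, Real.cos (p i) - μ))) ≠ 0 :=
    fun p => (by positivity : (0 : ℝ) < 1 + Real.exp (-(β * (2 * ∑ i, Real.cos (p i) - μ)))).ne'
  have hsum : Continuous fun p : Fin 2 → ℝ => ∑ i, Real.cos (p i) :=
    continuous_finsetSum _ fun i _ => Real.continuous_cos.comp (continuous_apply i)
  have hin : Continuous fun p : Fin 2 → ℝ => 1 + Real.exp (-(β * (2 * ∑ i, Real.cos (p i) - μ))) :=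
    continuous_const.add (Real.continuous_exp.comp
      ((continuous_const.mul ((continuous_const.mul hsum).sub continuous_const)).neg))
  exact continuous_const.mul (hin.log hpos)

/-- The torus band in corner coordinates: `ε_L(k) = 2 Σᵢ cos (c_k)ᵢ` (`latticeMomentum L k = c_k + (π, π)`). [folklore] -/
private theorem torusBand_eq_two_mul_sum_cos_cellCorner {L : ℕ} (k : TorusSite 2 L) :
    torusBand L k = 2 * ∑ i, Real.cos (cellCorner k i) := by
  rw [torusBand, latticeMomentum_eq_cellCorner_add]
  simp only [Pi.add_apply, Real.cos_add_pi, Finset.sum_neg_distrib, mul_neg, neg_mul, neg_neg]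

/-- One mode: `2 log 2 + (−x + 2 log cosh(x/2)) = 2 log(1 + e^{−x})`. [folklore] -/
private theorem two_log_two_add_neg_add_two_log_cosh_half (x : ℝ) :
    2 * Real.log 2 + (-x + 2 * Real.log (Real.cosh (x / 2))) = 2 * Real.log (1 + Real.exp (-x)) := by
  have h := log_one_add_cosh_div_two_eq_add_log x
  rw [log_one_add_cosh_div_two] at h
  linarith

/-- **The free grand-canonical partition function is the plane-wave product** (`L ≥ 3`):
`log Re Tr e^{−β(hubbardTorusTT' L 1 0 0 − μN)} = Σ_k freeLogWeight β μ (c_k)` (`= Σ_k 2 log(1 + e^{−β(ε_L(k) − μ)})`).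
[cite: AshcroftMermin1976, Ch. 2 eq. (2.49)] -/
theorem log_partitionFn_free_eq_sum {L : ℕ} [NeZero L] (hL : 3 ≤ L) (β μ : ℝ) :
    Real.log (partitionFn β (hubbardTorusTT' L 1 0 0 - (μ : ℂ) • totalNumber)).re =
      ∑ k : TorusSite 2 L, freeLogWeight β μ (cellCorner k) := by
  rw [hubbardTorusTT'_zero, ← hubbardTorusWith_eq, log_partitionFn_hubbardTorusWith_zero_eq hL β μ,
    card_orb_fermionTorus_two]
  have hcard : ((2 * L ^ 2 : ℕ) : ℝ) * Real.log 2 = ∑ _k : TorusSite 2 L, 2 * Real.log 2 := by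
    rw [Finset.sum_const, Finset.card_univ, card_torusSite_two, nsmul_eq_mul]
    push_cast
    ring
  rw [hcard, ← Finset.sum_add_distrib]
  refine Finset.sum_congr rfl fun k _ => ?_
  rw [freeLogWeight, ← torusBand_eq_two_mul_sum_cos_cellCorner,
    ← two_log_two_add_neg_add_two_log_cosh_half (β * (torusBand L k - μ))]

/-- **`L⁻² log Ξ_L(β, μ) → P₀(β, μ)`**: the per-site free grand-canonical log-partition function converges to the
Brillouin-zone integral (corner Riemann sums of a continuous function). [cite: FriedliVelenikSMLS2017, §10.5.2]
[cite: AshcroftMermin1976, Ch. 2 eq. (2.49)] -/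
theorem tendsto_log_partitionFn_free_div_sq (β μ : ℝ) :
    Tendsto (fun L : ℕ => Real.log (partitionFn β (hubbardTorusTT' L 1 0 0 - (μ : ℂ) • totalNumber)).re / (L : ℝ) ^ 2)
      atTop (𝓝 (freeGCPressure β μ)) := by
  have hR := (tendsto_cornerRiemannSum (d := 2) (continuous_freeLogWeight β μ).continuousOn).const_mul
    (((2 * π) ^ 2)⁻¹ : ℝ)
  refine hR.congr' ?_
  filter_upwards [eventually_ge_atTop 3] with L hL
  haveI : NeZero L := ⟨by omega⟩
  rw [log_partitionFn_free_eq_sum hL, ← HartreeFock.sum_cellCorner_div_eq]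

/-- **The free end of the chord: `p(β; 1,0,0; n) ≤ P₀(β, μ) − βμn` for every real `μ`** (`β ≥ 0`, `0 ≤ n < 2`): the
canonical sector pressure of the free gas is at most the Legendre bound from its grand-canonical pressure.
[cite: Ruelle1969, §3.4] [cite: AshcroftMermin1976, Ch. 2 eq. (2.49)] -/
theorem pressureTT'_free_le_freeGCPressure_sub {β : ℝ} (hβ : 0 ≤ β) {n : ℝ} (hn0 : 0 ≤ n) (hn2 : n < 2) (μ : ℝ) :
    pressureTT' β 1 0 0 n ≤ freeGCPressure β μ - β * μ * n := by
  have h := pressureTT'_add_le_of_grandCanonical_ceiling hβ 1 0 le_rfl hn0 hn2 tendsto_id (μ := μ)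
    (q := freeGCPressure β μ) fun ε hε => by
      have ht := tendsto_log_partitionFn_free_div_sq β μ
      filter_upwards [ht.eventually (eventually_le_nhds (show freeGCPressure β μ < freeGCPressure β μ + ε by linarith)),
        eventually_ge_atTop 1] with L hL hL1
      have hL2 : (0 : ℝ) < (L : ℝ) ^ 2 := by
        have : (1 : ℝ) ≤ L := by exact_mod_cast hL1
        positivity
      exact (div_le_iff₀ hL2).1 hL
  linarith

/-- Reader shape: a certified quadrature ceiling `P₀(β, μ) ≤ P` gives `p(β; 1,0,0; n) ≤ P − βμn`. [cite: Ruelle1969, §3.4] -/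
theorem pressureTT'_free_le_of_freeGCPressure_le {β : ℝ} (hβ : 0 ≤ β) {n : ℝ} (hn0 : 0 ≤ n) (hn2 : n < 2)
    {μ P : ℝ} (hP : freeGCPressure β μ ≤ P) : pressureTT' β 1 0 0 n ≤ P - β * μ * n :=
  (pressureTT'_free_le_freeGCPressure_sub hβ hn0 hn2 μ).trans (by linarith)

/-! ### §3 The thermal double-occupancy cap from the free-entropy chord -/

namespace InfVolFermionState

variable {n β : ℝ}

/-- **The thermal double occupancy is capped by the free-entropy chord** (`t = 1`, `t' = 0`): for every torus limit `ω`
of the canonical sector Gibbs states of `hubbardTorusTT' L 1 0 U` at `β > 0` (`U > 0`, `0 ≤ n < 2`), every real `μ` and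
every certified `T = 0` upper bound `e(1,0,U,n) ≤ e^{up}`:
`β·U·D(ω) ≤ P₀(β, μ) − βμn + β·e^{up}`. [cite: Lieb1973, §V (5.2)–(5.4)] [cite: Ruelle1969, §3.4] -/
theorem IsTorusLimitOfMixture.mul_meanEnergy_onSite_le_of_freeGCPressure_of_upper
    (hβ : 0 < β) (hn0 : 0 ≤ n) (hn2 : n < 2) {U : ℝ} (hU : 0 ≤ U) (μ : ℝ) {eup : ℝ}
    (hup : energyDensityTT' 1 0 U n ≤ eup)
    {ω : InfVolFermionState 2} {Ls : ℕ → ℕ}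
    (h : ω.IsTorusLimitOfMixture (sectorGibbsCount n) (fun L => sectorGibbsWeightTT' β 1 0 U n L)
      (fun L => sectorGibbsVectorTT' 1 0 U n L) Ls) (hLs : Tendsto Ls atTop atTop) :
    β * U * ω.meanEnergy (hubbardTTPrimeFermionInteraction 0 0 1) 1 ≤
      freeGCPressure β μ - β * μ * n + β * eup := by
  have h1 := h.mul_meanEnergy_onSite_le_pressureTT'_add_of_upper hβ hn0 hn2 le_rfl hU hup hLs
  have h2 := pressureTT'_free_le_freeGCPressure_sub hβ.le hn0 hn2 μ
  rw [sub_zero] at h1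
  linarith

/-- **Reader shape of the cap.** With a certified quadrature ceiling `P₀(β, μ) ≤ P`, a certified `T = 0` upper
`e(1,0,U,n) ≤ e^{up}` and any `d^{up} ≥ (P − βμn + β e^{up})/(βU)` (`U > 0`): `D(ω) ≤ d^{up}` for every thermal torus limit
at `(β, 1, 0, U, n)`. [cite: Lieb1973, §V (5.2)–(5.4)] [cite: Ruelle1969, §3.4] -/
theorem IsTorusLimitOfMixture.meanEnergy_onSite_le_of_freeGCPressure_le_of_upper
    (hβ : 0 < β) (hn0 : 0 ≤ n) (hn2 : n < 2) {U : ℝ} (hU : 0 < U) {μ P eup dup : ℝ}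
    (hP : freeGCPressure β μ ≤ P) (hup : energyDensityTT' 1 0 U n ≤ eup)
    (hd : (P - β * μ * n + β * eup) / (β * U) ≤ dup)
    {ω : InfVolFermionState 2} {Ls : ℕ → ℕ}
    (h : ω.IsTorusLimitOfMixture (sectorGibbsCount n) (fun L => sectorGibbsWeightTT' β 1 0 U n L)
      (fun L => sectorGibbsVectorTT' 1 0 U n L) Ls) (hLs : Tendsto Ls atTop atTop) :
    ω.meanEnergy (hubbardTTPrimeFermionInteraction 0 0 1) 1 ≤ dup := by
  have h1 := h.mul_meanEnergy_onSite_le_of_freeGCPressure_of_upper hβ hn0 hn2 hU.le μ hup hLs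
  have hβU : 0 < β * U := mul_pos hβ hU
  refine le_trans ?_ hd
  rw [le_div_iff₀ hβU]
  linarith

/-- **Word shape** (`Re ω_{{0}}(n_{0↑}n_{0↓}) ≤ d^{up}`, the hypothesis shape of the KT back-end's d-route factories).
[cite: Lieb1973, §V (5.2)–(5.4)] [cite: Ruelle1969, §3.4] -/
theorem IsTorusLimitOfMixture.re_expect_docc_le_of_freeGCPressure_le_of_upper
    (hβ : 0 < β) (hn0 : 0 ≤ n) (hn2 : n < 2) {U : ℝ} (hU : 0 < U) {μ P eup dup : ℝ}
    (hP : freeGCPressure β μ ≤ P) (hup : energyDensityTT' 1 0 U n ≤ eup)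
    (hd : (P - β * μ * n + β * eup) / (β * U) ≤ dup)
    {ω : InfVolFermionState 2} {Ls : ℕ → ℕ}
    (h : ω.IsTorusLimitOfMixture (sectorGibbsCount n) (fun L => sectorGibbsWeightTT' β 1 0 U n L)
      (fun L => sectorGibbsVectorTT' 1 0 U n L) Ls) (hLs : Tendsto Ls atTop atTop) :
    (ω.expect ({0} : Finset (Site 2))
      (nAt 0 (Finset.mem_singleton_self 0) 0 * nAt 0 (Finset.mem_singleton_self 0) 1)).re ≤ dup := by
  rw [← h.meanEnergy_onSite_eq_re_expect_docc hLs]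
  exact h.meanEnergy_onSite_le_of_freeGCPressure_le_of_upper hβ hn0 hn2 hU hP hup hd hLs

end InfVolFermionState

end Literature.MathematicalPhysics.QuantumLattice

end
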